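import Literature.NumberTheory.ComplexMultiplication.CMOrderInvertibleIdealLocalization
import Literature.NumberTheory.ComplexMultiplication.CMOrderOverorderPicardClasses
import Literature.NumberTheory.ComplexMultiplication.CMOrderPicardToClassGroup
import Mathlib.RingTheory.FractionalIdeal.Extended
import Mathlib.RingTheory.Ideal.GoingUp
import HarnessLib

/-!
# Every invertible ideal of an over-order is extended from the order: for `R ⊆ T ⊆ K = Frac R`
# (`T` integral over the one-dimensional noetherian domain `R`), each invertible fractional `T`-ideal is
# `I·T` for an INVERTIBLE fractional `R`-ideal `I`; «the extension map `I ↦ IS` induces a surjective group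
# homomorphism `Pic(R) ↠ Pic(S)`» (Marseglia, *Computing the ideal class monoid of an order*, Remark 3.8, after
# Dade–Taussky–Zassenhaus)

Family `hodge`, lane `lit-hodgefound` (Track 2 foundations library; seat p15, row g26-#1), topic
`Literature/NumberTheory/ComplexMultiplication`, namespaces `Literature.NumberTheory.ComplexMultiplication.NumberRing`
(§§1–3: the statements are proved for every tower `R → T → K` of integral domains with COMMON fraction field `K`,
`T` integral over `R`, both noetherian of dimension `≤ 1` — an order and an over-order of a number field, Dedekind
or not), `Literature.NumberTheory.ComplexMultiplication.CMTypeLattice` (§4: the "arbitrary order" series,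
`𝔯 = endOrder (M_μ) ≤ S = endOrder (M_ν)` inside a number field `K` of any degree, as in
`CMOrderOverorderPicardClasses`) and `Literature.NumberTheory.ComplexMultiplication.EndOrder` (§5: the maximal
order `𝒪 = 𝓞_K` over `𝔯 = endOrder ρ`, as in `CMOrderPicardToClassGroup`).  THEOREMS ONLY: no definition, no
instance, no named fact (net Literature debt `0`).

Carriers (no new definition): the local ring `T_𝔮 ⊆ K` at a maximal ideal `𝔮` is Mathlib's
`Localization.subalgebra.ofField K 𝔮.primeCompl _`, the local component `J_𝔮 = J·T_𝔮` of a fractional ideal is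
`Submodule.span T_𝔮 (J : Set K)` (as in `CMOrderLocallyPrincipal`, `CMOrderInvertibleIdealLocalization`), and the
extension `I ↦ I·T` of fractional ideals along `R → T` is Mathlib's `FractionalIdeal.extended K _ I`
(`Mathlib.RingTheory.FractionalIdeal.Extended`; here both fraction fields are `K`, so `↑(I·T) = span T ↑I`,
`coe_extended_algebraMap_eq_span`).  The tree has the surjectivity `Pic(𝔯) ↠ Cl(𝓞_K)` onto the MAXIMAL order only
(`CMOrderPicardSurjective.classGroupMap_surjective`, Stevenhagen Thm. 6.7, through ideals coprime to the
conductor — a Dedekind-target argument); the relative statement for an arbitrary over-order is new here and is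
proved by the local method.

## Sources, VERBATIM

S. Marseglia, *Computing the ideal class monoid of an order*, J. Lond. Math. Soc. (2) 101 (2020) 984–1007
[Marseglia2019] (read in arXiv:1805.09671, held `paper:arxiv-1805.09671`, whose numbering is quoted):
* chunk p0006 (Remark 3.8): "Note that if `S` is an over-order of `R`, then the extension map `I ↦ IS` induces a
  surjective group homomorphism `Pic(R) ↠ Pic(S)`, see for example [dadetz62]."
* chunk p0008 (proof of Proposition 4.1, (3) ⟹ (1)): "Let `L′` be any invertible ideal in `R` such that
  `L′S = L`. Note that such an `L′` exists since the extension map `Pic(R) → Pic(S)` is surjective, as we explain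
  in Remark 3.8. The localization `L′_𝔭` at any prime `𝔭` of `R` is principal by Lemma 2.7, say `L′_𝔭 = xR_𝔭`."
* chunk p0005 (Lemma 2.7 [Gilmer92]): "Let `T` be a ring with finitely many maximal ideals and let `I` be a
  `T`-ideal. Then `I` is invertible in `T` if and only if `I` is principal and generated by a non-zero divisor."
  and (Lemma 2.8) "`I` is invertible in `R` if and only if `I_𝔭` is principal for every prime `𝔭` of `R`."
The original is E. C. Dade, O. Taussky, H. Zassenhaus, *On the theory of orders, in particular on the semigroup
of ideal classes and genera of an order in an algebraic number field*, Math. Ann. 148 (1962) 31–64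
[DadeTausskyZassenhaus1962] (not held; cited through Marseglia's locator).
P. Stevenhagen, *The arithmetic of number rings* [Stevenhagen2008NumberRings], §5 Thm. 5.3 p. 219
(`𝓘(R) ≅ ⊕_𝔭 𝓟(R_𝔭)`, the tree's `CMOrderInvertibleIdealLocalization`) and §4 (4-3) p. 217 (`I = ⋂_𝔭 I_𝔭`) supply
the two global steps of the proof below.

## The proof formalised (the local method; no semilocal ring is constructed)

Let `J ∈ 𝓘(T)`.  (i) Over a maximal ideal `𝔭` of `R` lie finitely many maximal ideals `𝔮₁, …, 𝔮ₘ` of `T`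
(`finite_setOf_under_eq`), and `J` has ONE common local generator there: `J_{𝔮ᵢ} = x_𝔭T_{𝔮ᵢ}` for all `i`
(`exists_ne_zero_forall_span_coe_eq_span_singleton` — Lemma 2.7 for the semilocal ring `T_𝔭`, proved inline by
the Chinese remainder theorem: `x_𝔭 = Σᵢ eᵢyᵢ` with `J_{𝔮ᵢ} = yᵢT_{𝔮ᵢ}`, `eᵢ ≡ 1 (𝔮ᵢ)`, `eᵢ ≡ 0 (𝔮ⱼ)`, and
`x_𝔭 = uᵢyᵢ` with `uᵢ ∈ T_{𝔮ᵢ}^*` because `T_{𝔮ᵢ}` is local).  (ii) By Theorem 5.3 for `R` there is `I ∈ 𝓘(R)`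
with `I_𝔭 = x_𝔭R_𝔭` at the finitely many `𝔭` below the support of `J` and `I_𝔭 = R_𝔭` elsewhere
(`NumberRing.exists_isUnit_forall_span_coe_eq`).  (iii) Since `R_𝔭 ⊆ T_𝔮` for `𝔮 ∩ R = 𝔭`,
`(I·T)_𝔮 = I_𝔭·T_𝔮 = x_𝔭T_𝔮 = J_𝔮` for every `𝔮`, so `I·T = J` by (4-3) for `T`
(`NumberRing.eq_iff_forall_span_coe_eq`).

## What is formalised

* §1 (any domain `T` with fraction field `K`) **`NumberRing.exists_ne_zero_forall_span_coe_eq_span_singleton`**: an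
  invertible ideal has a common local generator over any finite set of maximal ideals (Lemma 2.7, CRT form).
* §2 (tower `R → T → K`) plumbing: `algebraMap_injective_of_isFractionRing`, `nonZeroDivisors_le_comap_algebraMap`,
  `finite_setOf_under_eq` (finitely many `𝔮` over `𝔭`), `isLocalizationMap_eq_id` /
  **`coe_extended_algebraMap_eq_span`** (`↑(I·T) = span_T ↑I`), `isUnit_extended` (`I ∈ 𝓘(R) ⟹ I·T ∈ 𝓘(T)`),
  `coe_ofField_subset_ofField_of_under_eq` (`R_𝔭 ⊆ T_𝔮`), `span_span_ofField_of_under_eq` (`(N·R_𝔭)·T_𝔮 = N·T_𝔮`).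
* §3 **`NumberRing.exists_isUnit_span_coe_eq_coe`** / **`NumberRing.exists_isUnit_extended_eq`** (every `J ∈ 𝓘(T)`
  is `I·T`, `I ∈ 𝓘(R)`) and the packaged surjection **`unitsMap_extendedHom'_surjective`**: `𝓘(R) → 𝓘(T)`,
  `I ↦ I·T`, is ONTO.
* §4 the order series `𝔯 = endOrder (M_μ) ≤ S = endOrder (M_ν)` (`f = Subring.inclusion`):
  `nonZeroDivisors_le_comap_inclusion`, `isIntegral_inclusion` (`S` is integral over `𝔯`),
  **`CMTypeLattice.exists_isUnit_extended_inclusion_eq`**, `exists_isUnit_span_coe_eq_coe`,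
  `unitsMap_extendedHom'_inclusion_surjective`; on the base carrier: `coe_mul_eq_span_of_coe_eq` (`↑(N·P) = span_S ↑N`
  for `↑P = S`) and **`exists_isUnit_mul_eq_of_mul_div_self_div_eq`** — an `𝔯`-ideal `L` of the `Pic(S)`-stratum
  (`↑(L:L) = S`, `L·(S:L) = S`, cf. `CMOrderOverorderPicardClasses`) is `L₀·P` with `L₀ ∈ 𝓘(𝔯)`.
* §5 **`EndOrder.exists_isUnit_extend_eq`**: every nonzero fractional ideal of `𝒪 = 𝓞_K` is `extend ρ I = I·𝒪` with
  `I ∈ 𝓘(𝔯)` (ideal-level companion of `CMOrderPicardSurjective.classGroupMap_surjective`).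
-/

open scoped nonZeroDivisors NumberField
open Module FractionalIdeal NumberField

namespace Literature.NumberTheory.ComplexMultiplication

namespace NumberRing

/-! ## §1 A common local generator over finitely many maximal ideals (Marseglia Lemma 2.7, by CRT) -/

section CommonGenerator

variable {T : Type*} [CommRing T] [IsDomain T] {K : Type*} [Field K] [Algebra T K] [IsFractionRing T K]

/-- In the local ring `T_𝔮`, a unit plus an element of the maximal ideal is a unit (plumbing). [folklore] -/
private theorem isUnit_add_of_mem_maximalIdeal {A : Type*} [CommRing A] [IsLocalRing A] {a b : A}
    (ha : IsUnit a) (hb : b ∈ IsLocalRing.maximalIdeal A) : IsUnit (a + b) := by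
  by_contra h
  have hab : a + b ∈ IsLocalRing.maximalIdeal A := (IsLocalRing.mem_maximalIdeal _).2 h
  have : a ∈ IsLocalRing.maximalIdeal A := by
    have := Ideal.sub_mem _ hab hb
    rwa [add_sub_cancel_right] at this
  exact (IsLocalRing.mem_maximalIdeal _).1 this ha

/-- **MARSEGLIA LEMMA 2.7 [Gilmer92] in Chinese-remainder form: an invertible fractional ideal `J` of a domain
`T` has ONE common local generator over any finite set `F` of maximal ideals — `J_𝔮 = xT_𝔮` for all `𝔮 ∈ F`
with a single `x ∈ K^*`** («Let `T` be a ring with finitely many maximal ideals and let `I` be a `T`-ideal.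
Then `I` is invertible in `T` if and only if `I` is principal and generated by a non-zero divisor», applied to
the semilocalisation of `T` at `F`; proof: `J_𝔮 = y_𝔮T_𝔮` (Prop. 4.4), `e_𝔮 ≡ 1 mod 𝔮`, `e_𝔮 ≡ 0 mod 𝔮′ ≠ 𝔮`
(CRT), `x = Σ e_𝔮y_𝔮 = u_𝔮·y_𝔮` with `u_𝔮` a unit of the local ring `T_𝔮`).
[cite: Marseglia2019, §2 Lemma 2.7 and Lemma 2.8, p. 5] [cite: Stevenhagen2008NumberRings, §4 Prop. 4.4, p. 217] -/
theorem exists_ne_zero_forall_span_coe_eq_span_singleton (F : Finset (MaximalSpectrum T))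
    {J : FractionalIdeal T⁰ K} (hJ : IsUnit J) :
    ∃ x : K, x ≠ 0 ∧ ∀ 𝔮 ∈ F,
      Submodule.span (Localization.subalgebra.ofField K 𝔮.asIdeal.primeCompl
          𝔮.asIdeal.primeCompl_le_nonZeroDivisors) (J : Set K) =
        Submodule.span (Localization.subalgebra.ofField K 𝔮.asIdeal.primeCompl
          𝔮.asIdeal.primeCompl_le_nonZeroDivisors) {x} := by
  classical
  -- local generators `y_𝔮 ∈ J ∩ K^*`, `J_𝔮 = y_𝔮T_𝔮`
  have hgen : ∀ 𝔮 : MaximalSpectrum T, ∃ y ∈ J, y ≠ 0 ∧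
      Submodule.span (Localization.subalgebra.ofField K 𝔮.asIdeal.primeCompl
          𝔮.asIdeal.primeCompl_le_nonZeroDivisors) (J : Set K) =
        Submodule.span (Localization.subalgebra.ofField K 𝔮.asIdeal.primeCompl
          𝔮.asIdeal.primeCompl_le_nonZeroDivisors) {y} := fun 𝔮 ↦ by
    haveI := 𝔮.isMaximal.isPrime
    exact exists_ne_zero_span_coe_eq_span_singleton hJ 𝔮.asIdeal
  choose y hyJ hy0 hy using hgen
  rcases F.eq_empty_or_nonempty with rfl | hF
  · exact ⟨1, one_ne_zero, fun 𝔮 h ↦ absurd h (Finset.notMem_empty 𝔮)⟩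
  -- CRT: `e_𝔮 ≡ 1 mod 𝔮`, `e_𝔮 ∈ 𝔮′` for `𝔮′ ∈ F ∖ {𝔮}`
  have hcop : Pairwise (Function.onFun IsCoprime fun 𝔮 : F ↦ (𝔮 : MaximalSpectrum T).asIdeal) :=
      fun 𝔮 𝔮' hne ↦
    (Ideal.isCoprime_iff_sup_eq).2 ((𝔮 : MaximalSpectrum T).isMaximal.coprime_of_ne
      (𝔮' : MaximalSpectrum T).isMaximal fun h ↦ hne (Subtype.ext (MaximalSpectrum.ext h)))
  have hcrt : ∀ 𝔮 : F, ∃ e : T, e - 1 ∈ (𝔮 : MaximalSpectrum T).asIdeal ∧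
      ∀ 𝔮' : F, 𝔮' ≠ 𝔮 → e ∈ (𝔮' : MaximalSpectrum T).asIdeal := fun 𝔮 ↦ by
    obtain ⟨e, he⟩ := Ideal.exists_forall_sub_mem_ideal hcop fun 𝔮' ↦ if 𝔮' = 𝔮 then (1 : T) else 0
    refine ⟨e, by simpa using he 𝔮, fun 𝔮' hne ↦ by simpa [hne] using he 𝔮'⟩
  choose e he1 he0 using hcrt
  -- the common generator
  set x : K := ∑ 𝔮 : F, algebraMap T K (e 𝔮) * y 𝔮 with hx
  have key : ∀ 𝔮 : F,
      Submodule.span (Localization.subalgebra.ofField K (𝔮 : MaximalSpectrum T).asIdeal.primeCompl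
          (𝔮 : MaximalSpectrum T).asIdeal.primeCompl_le_nonZeroDivisors) {x} =
        Submodule.span (Localization.subalgebra.ofField K (𝔮 : MaximalSpectrum T).asIdeal.primeCompl
          (𝔮 : MaximalSpectrum T).asIdeal.primeCompl_le_nonZeroDivisors) {y 𝔮} := by
    intro 𝔮
    haveI := (𝔮 : MaximalSpectrum T).isMaximal.isPrime
    set A := Localization.subalgebra.ofField K (𝔮 : MaximalSpectrum T).asIdeal.primeCompl
      (𝔮 : MaximalSpectrum T).asIdeal.primeCompl_le_nonZeroDivisors with hA
    haveI : IsLocalRing A := IsLocalization.AtPrime.isLocalRing A (𝔮 : MaximalSpectrum T).asIdeal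
    -- every `y_𝔮′` is an `A`-multiple of `y_𝔮` (`y_𝔮′ ∈ J ⊆ J_𝔮 = y_𝔮A`), with multiplier `1` for `𝔮′ = 𝔮`
    have hmul : ∀ 𝔮' : F, ∃ t : A, t • y 𝔮 = y 𝔮' ∧ (𝔮' = 𝔮 → t = 1) := fun 𝔮' ↦ by
      by_cases h : 𝔮' = 𝔮
      · exact ⟨1, by rw [h, one_smul], fun _ ↦ rfl⟩
      · have hmem : y 𝔮' ∈ Submodule.span A (J : Set K) := Submodule.subset_span (hyJ 𝔮')
        rw [hy 𝔮] at hmem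
        obtain ⟨t, ht⟩ := Submodule.mem_span_singleton.1 hmem
        exact ⟨t, ht, fun h' ↦ absurd h' h⟩
    choose t ht ht1 using hmul
    set u : A := ∑ 𝔮' : F, algebraMap T A (e 𝔮') * t 𝔮' with hu
    have hxu : x = u • y 𝔮 := by
      rw [hx, hu, Finset.sum_smul]
      refine Finset.sum_congr rfl fun 𝔮' _ ↦ ?_
      rw [mul_smul, ht 𝔮', Algebra.smul_def, ← IsScalarTower.algebraMap_apply]
    have hunit : IsUnit u := by
      rw [hu, ← Finset.add_sum_erase Finset.univ _ (Finset.mem_univ 𝔮), ht1 𝔮 rfl, mul_one]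
      refine isUnit_add_of_mem_maximalIdeal ?_ (Ideal.sum_mem _ fun 𝔮' h𝔮' ↦ Ideal.mul_mem_right _ _ ?_)
      · refine (IsLocalization.AtPrime.isUnit_to_map_iff A (𝔮 : MaximalSpectrum T).asIdeal (e 𝔮)).2
          fun he ↦ (𝔮 : MaximalSpectrum T).isMaximal.ne_top ((Ideal.eq_top_iff_one _).2 ?_)
        have := Ideal.sub_mem _ he (he1 𝔮)
        rwa [sub_sub_cancel] at this
      · exact (IsLocalization.AtPrime.to_map_mem_maximal_iff A (𝔮 : MaximalSpectrum T).asIdeal (e 𝔮')).2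
          (he0 𝔮' 𝔮 (Finset.ne_of_mem_erase h𝔮').symm)
    rw [hxu, Submodule.span_singleton_smul_eq hunit]
  obtain ⟨𝔮₀, h𝔮₀⟩ := hF
  refine ⟨x, fun hx0 ↦ hy0 𝔮₀ ?_, fun 𝔮 h𝔮 ↦ (hy 𝔮).trans (key ⟨𝔮, h𝔮⟩).symm⟩
  have hmem := Submodule.mem_span_singleton_self (R := Localization.subalgebra.ofField K 𝔮₀.asIdeal.primeCompl
    𝔮₀.asIdeal.primeCompl_le_nonZeroDivisors) (y 𝔮₀)
  rw [← key ⟨𝔮₀, h𝔮₀⟩, hx0, Submodule.span_singleton_eq_bot.2 rfl] at hmem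
  exact (Submodule.mem_bot _).1 hmem

end CommonGenerator

/-! ## §2 The tower `R → T → K`: extension of fractional ideals, `R_𝔭 ⊆ T_𝔮`, finitely many `𝔮` over `𝔭` -/

section Tower

variable {R : Type*} [CommRing R] [IsDomain R] {T : Type*} [CommRing T] [IsDomain T] [Algebra R T]

omit [IsDomain R] [IsDomain T] in
/-- `R → T` is injective: both embed in the common fraction field `K` (plumbing for the over-order situation
`R ⊆ T ⊆ K`). [cite: Marseglia2019, §2 («The fractional `R`-ideals that are rings are called over-orders of `R`»: `R ⊆ S ⊂ K`), p. 4] -/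
theorem algebraMap_injective_of_isFractionRing (K : Type*) [Field K] [Algebra R K] [IsFractionRing R K]
    [Algebra T K] [IsScalarTower R T K] : Function.Injective (algebraMap R T) := fun a b h ↦
  IsFractionRing.injective R K (by rw [IsScalarTower.algebraMap_apply R T K, h, ← IsScalarTower.algebraMap_apply])

omit [IsDomain R] in
/-- `R ∖ 0` maps into `T ∖ 0` — the hypothesis of Mathlib's `FractionalIdeal.extended` (plumbing for `R ⊆ T ⊆ K`).
[cite: Marseglia2019, §2 («The fractional `R`-ideals that are rings are called over-orders of `R`»: `R ⊆ S ⊂ K`), p. 4] -/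
theorem nonZeroDivisors_le_comap_algebraMap (K : Type*) [Field K] [Algebra R K] [IsFractionRing R K]
    [Algebra T K] [IsScalarTower R T K] : R⁰ ≤ Submonoid.comap (algebraMap R T) T⁰ :=
  nonZeroDivisors_le_comap_nonZeroDivisors_of_injective _ (algebraMap_injective_of_isFractionRing K)

/-- **Over a maximal ideal `𝔭` of `R` lie only finitely many maximal ideals of `T`** (`T` integral over the
one-dimensional noetherian `R`, same fraction field `K`: they all contain `𝔭T ≠ 0`; plumbing for «`R_{(p)}` is a
semi-local ring»). [cite: Marseglia2019, §4 Remark 4.3, p. 8] [cite: Stevenhagen2008NumberRings, §5 Thm. 5.2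
(«the primes `𝔭 ⊇ I`» are finitely many), p. 218] -/
theorem finite_setOf_under_eq (K : Type*) [Field K] [Algebra R K] [IsFractionRing R K] [Algebra T K]
    [IsScalarTower R T K] [IsNoetherianRing T] [Ring.DimensionLEOne T] [Algebra.IsIntegral R T]
    (𝔭 : MaximalSpectrum R) :
    {𝔮 : MaximalSpectrum T | 𝔮.asIdeal.under R = 𝔭.asIdeal}.Finite := by
  by_cases h0 : 𝔭.asIdeal = ⊥
  · refine Set.Subsingleton.finite fun 𝔮 h𝔮 𝔮' h𝔮' ↦ MaximalSpectrum.ext ?_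
    rw [Set.mem_setOf_eq, h0] at h𝔮 h𝔮'
    rw [Ideal.eq_bot_of_comap_eq_bot h𝔮, Ideal.eq_bot_of_comap_eq_bot h𝔮']
  · refine (finite_setOf_le (I := 𝔭.asIdeal.map (algebraMap R T)) ?_).subset fun 𝔮 h𝔮 ↦ ?_
    · rwa [Ne, Ideal.map_eq_bot_iff_of_injective (algebraMap_injective_of_isFractionRing K)]
    · exact Ideal.map_le_iff_le_comap.2 (le_of_eq (h𝔮 : 𝔮.asIdeal.under R = 𝔭.asIdeal).symm)

variable {K : Type*} [Field K] [Algebra R K] [IsFractionRing R K] [Algebra T K] [IsFractionRing T K]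
  [IsScalarTower R T K]

omit [IsDomain R] [IsDomain T] in
/-- The induced map of fraction fields `K → K` along `R → T` is the identity (both are `K`; plumbing for «the
extension map `I ↦ IS`» inside one field). [cite: Marseglia2019, §3 Remark 3.8, p. 6] -/
theorem isLocalizationMap_eq_id (hf : R⁰ ≤ Submonoid.comap (algebraMap R T) T⁰) :
    IsLocalization.map (S := K) K (algebraMap R T) hf = RingHom.id K :=
  IsLocalization.ringHom_ext R⁰ (by rw [IsLocalization.map_comp, RingHom.id_comp, IsScalarTower.algebraMap_eq R T K])

omit [IsDomain R] [IsDomain T] in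
/-- **`↑(I·T) = span_T ↑I`**: inside the common fraction field `K`, the extension `I·T = FractionalIdeal.extended K _ I`
of a fractional `R`-ideal to `T` is the `T`-module spanned by `I` («the extension map `I ↦ IS`»).
[cite: Marseglia2019, §3 Remark 3.8, p. 6] -/
theorem coe_extended_algebraMap_eq_span (hf : R⁰ ≤ Submonoid.comap (algebraMap R T) T⁰)
    (I : FractionalIdeal R⁰ K) :
    ((I.extended K hf : FractionalIdeal T⁰ K) : Submodule T K) = Submodule.span T (I : Set K) := by
  rw [coe_extended_eq_span, isLocalizationMap_eq_id, RingHom.coe_id, Set.image_id]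

omit [IsDomain R] [IsDomain T] in
/-- `↑(I·T) = span_T ↑I` as subsets of `K` (plumbing). [cite: Marseglia2019, §3 Remark 3.8, p. 6] -/
theorem coe_extended_algebraMap_eq_span' (hf : R⁰ ≤ Submonoid.comap (algebraMap R T) T⁰)
    (I : FractionalIdeal R⁰ K) :
    ((I.extended K hf : FractionalIdeal T⁰ K) : Set K) = (Submodule.span T (I : Set K) : Set K) := by
  rw [← coeToSet_coeToSubmodule, coe_extended_algebraMap_eq_span]

omit [IsDomain R] [IsDomain T] [IsScalarTower R T K] in
/-- **`I ∈ 𝓘(R) ⟹ I·T ∈ 𝓘(T)`**: the extension of an invertible ideal is invertible (`(I·T)(I⁻¹·T) = (II⁻¹)·T = T`;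
«induces a … group homomorphism `Pic(R) → Pic(S)`»). [cite: Marseglia2019, §3 Remark 3.8, p. 6] -/
theorem isUnit_extended (hf : R⁰ ≤ Submonoid.comap (algebraMap R T) T⁰) {I : FractionalIdeal R⁰ K}
    (hI : IsUnit I) : IsUnit (I.extended K hf : FractionalIdeal T⁰ K) :=
  hI.map (extendedHom' (A := R) (K := K) K hf)

/-- **`R_𝔭 ⊆ T_𝔮` for a maximal ideal `𝔮` of `T` above `𝔭 = 𝔮 ∩ R`**: a fraction `a/s`, `s ∈ R ∖ 𝔭`, has
denominator `s ∈ T ∖ 𝔮` (plumbing for «`L′S = L` … `L′_𝔭 = xR_𝔭`. Then `I_𝔭 = xJ_𝔭`»).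
[cite: Marseglia2019, §4, proof of Prop. 4.1 ((3) ⟹ (1)), p. 8] -/
theorem coe_ofField_subset_ofField_of_under_eq {𝔭 : Ideal R} [𝔭.IsPrime] {𝔮 : Ideal T} [𝔮.IsPrime]
    (h : 𝔮.under R = 𝔭) :
    ((Localization.subalgebra.ofField K 𝔭.primeCompl 𝔭.primeCompl_le_nonZeroDivisors : Subalgebra R K) : Set K) ⊆
      (Localization.subalgebra.ofField K 𝔮.primeCompl 𝔮.primeCompl_le_nonZeroDivisors : Subalgebra T K) := by
  rintro x ⟨a, s, hs, rfl⟩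
  refine ⟨algebraMap R T a, algebraMap R T s, fun hs𝔮 ↦ hs ?_, ?_⟩
  · subst h; exact hs𝔮
  · rw [← IsScalarTower.algebraMap_apply, ← IsScalarTower.algebraMap_apply]

/-- **`(N·R_𝔭)·T_𝔮 = N·T_𝔮`** for `𝔮 ∩ R = 𝔭` and any subset `N ⊆ K`: localising at `𝔭` first and then at `𝔮`
is localising at `𝔮` (plumbing for «`L′_𝔭 = xR_𝔭`. Then `I_𝔭 = xJ_𝔭`»).
[cite: Marseglia2019, §4, proof of Prop. 4.1 ((3) ⟹ (1)), p. 8] -/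
theorem span_span_ofField_of_under_eq {𝔭 : Ideal R} [𝔭.IsPrime] {𝔮 : Ideal T} [𝔮.IsPrime]
    (h : 𝔮.under R = 𝔭) (N : Set K) :
    Submodule.span (Localization.subalgebra.ofField K 𝔮.primeCompl 𝔮.primeCompl_le_nonZeroDivisors)
        (Submodule.span (Localization.subalgebra.ofField K 𝔭.primeCompl 𝔭.primeCompl_le_nonZeroDivisors) N :
          Set K) =
      Submodule.span (Localization.subalgebra.ofField K 𝔮.primeCompl 𝔮.primeCompl_le_nonZeroDivisors) N := by
  refine le_antisymm (Submodule.span_le.2 fun x hx ↦ ?_) (Submodule.span_mono Submodule.subset_span)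
  induction hx using Submodule.span_induction with
  | mem x hx => exact Submodule.subset_span hx
  | zero => exact Submodule.zero_mem _
  | add x y _ _ hx hy => exact Submodule.add_mem _ hx hy
  | smul r x _ hx =>
    rw [Subalgebra.smul_def]
    have hr := coe_ofField_subset_ofField_of_under_eq (K := K) h r.2
    exact Submodule.smul_mem _
      (⟨(r : K), hr⟩ : Localization.subalgebra.ofField K 𝔮.primeCompl 𝔮.primeCompl_le_nonZeroDivisors) hx

end Tower

/-! ## §3 Every invertible `T`-ideal is `I·T` with `I ∈ 𝓘(R)`: `𝓘(R) → 𝓘(T)` is onto -/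

section Surjective

variable {R : Type*} [CommRing R] [IsDomain R] {T : Type*} [CommRing T] [IsDomain T]
  {K : Type*} [Field K] [Algebra R K] [IsFractionRing R K] [Algebra T K] [IsFractionRing T K]
  [Algebra R T] [IsScalarTower R T K]
  [IsNoetherianRing R] [Ring.DimensionLEOne R] [IsNoetherianRing T] [Ring.DimensionLEOne T]
  [Algebra.IsIntegral R T]

/-- **Every invertible `T`-ideal is spanned by an invertible `R`-ideal: `J = span_T ↑I`, `I ∈ 𝓘(R)`** — the
span form of the theorem below («Let `L′` be any invertible ideal in `R` such that `L′S = L` … such an `L′`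
exists»).  Proof = the module docstring: common local generators `x_𝔭` over each `𝔭` (§1), `I` with
`I_𝔭 = x_𝔭R_𝔭` (Thm. 5.3), `(I·T)_𝔮 = J_𝔮` for every `𝔮`, (4-3).
[cite: Marseglia2019, §3 Remark 3.8, p. 6; §4, proof of Prop. 4.1 ((3) ⟹ (1)), p. 8]
[cite: DadeTausskyZassenhaus1962, (cited through Marseglia2019 Remark 3.8)]
[cite: Stevenhagen2008NumberRings, §5 Thm. 5.3, p. 219; §4 (4-3), p. 217] -/
theorem exists_isUnit_span_coe_eq_coe {J : FractionalIdeal T⁰ K} (hJ : IsUnit J) :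
    ∃ I : FractionalIdeal R⁰ K, IsUnit I ∧ Submodule.span T (I : Set K) = (J : Submodule T K) := by
  classical
  -- (i) a common local generator `x_𝔭` of `J` over each maximal `𝔭` of `R`
  have hgen : ∀ 𝔭 : MaximalSpectrum R, ∃ x : K, x ≠ 0 ∧ ∀ 𝔮 : MaximalSpectrum T,
      𝔮.asIdeal.under R = 𝔭.asIdeal →
        Submodule.span (Localization.subalgebra.ofField K 𝔮.asIdeal.primeCompl
            𝔮.asIdeal.primeCompl_le_nonZeroDivisors) (J : Set K) =
          Submodule.span (Localization.subalgebra.ofField K 𝔮.asIdeal.primeCompl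
            𝔮.asIdeal.primeCompl_le_nonZeroDivisors) {x} := fun 𝔭 ↦ by
    obtain ⟨x, hx0, hx⟩ :=
      exists_ne_zero_forall_span_coe_eq_span_singleton (finite_setOf_under_eq K 𝔭).toFinset hJ
    exact ⟨x, hx0, fun 𝔮 h𝔮 ↦ hx 𝔮 ((finite_setOf_under_eq K 𝔭).mem_toFinset.2 h𝔮)⟩
  choose x hx0 hx using hgen
  -- (ii) `I ∈ 𝓘(R)` with `I_𝔭 = x_𝔭R_𝔭` below the support of `J`, `I_𝔭 = R_𝔭` elsewhere
  have hsupp := finite_setOf_span_coe_ne_span_one hJ.ne_zero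
  let under : MaximalSpectrum T → MaximalSpectrum R := fun 𝔮 ↦
    ⟨𝔮.asIdeal.under R, @Ideal.IsMaximal.under R _ T _ _ _ 𝔮.asIdeal 𝔮.isMaximal⟩
  obtain ⟨I, hI, hI1, hI2⟩ :=
    exists_isUnit_forall_span_coe_eq (hsupp.toFinset.image under) x fun 𝔭 _ ↦ hx0 𝔭
  refine ⟨I, hI, ?_⟩
  -- (iii) `(I·T)_𝔮 = J_𝔮` for every maximal `𝔮` of `T`
  obtain ⟨I', hI'⟩ : ∃ I' : FractionalIdeal T⁰ K, (I' : Submodule T K) = Submodule.span T (I : Set K) :=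
    ⟨I.extended K (nonZeroDivisors_le_comap_algebraMap K), coe_extended_algebraMap_eq_span _ I⟩
  rw [← hI']
  refine congrArg _ (eq_iff_forall_span_coe_eq.2 fun 𝔮 ↦ ?_)
  haveI := 𝔮.isMaximal.isPrime
  haveI := (under 𝔮).isMaximal.isPrime
  have h𝔮 : 𝔮.asIdeal.under R = (under 𝔮).asIdeal := rfl
  rw [← coeToSet_coeToSubmodule I', hI', Submodule.span_span_of_tower, ← span_span_ofField_of_under_eq (K := K) h𝔮]
  by_cases hmem : under 𝔮 ∈ hsupp.toFinset.image under
  · rw [hI1 _ hmem, span_span_ofField_of_under_eq (K := K) h𝔮, hx (under 𝔮) 𝔮 h𝔮]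
  · rw [hI2 _ hmem, span_span_ofField_of_under_eq (K := K) h𝔮]
    have h𝔮supp : 𝔮 ∉ hsupp.toFinset := fun h ↦ hmem (Finset.mem_image_of_mem under h)
    rw [Set.Finite.mem_toFinset, Set.mem_setOf_eq, not_not] at h𝔮supp
    exact h𝔮supp.symm

/-- **MARSEGLIA REMARK 3.8 / DADE–TAUSSKY–ZASSENHAUS at the level of ideals: every invertible fractional ideal of
the over-order `T` is `I·T` for an INVERTIBLE fractional `R`-ideal `I`** («if `S` is an over-order of `R`, then
the extension map `I ↦ IS` induces a surjective group homomorphism `Pic(R) ↠ Pic(S)`»; «Let `L′` be any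
invertible ideal in `R` such that `L′S = L` … such an `L′` exists»).
[cite: Marseglia2019, §3 Remark 3.8, p. 6; §4, proof of Prop. 4.1, p. 8]
[cite: DadeTausskyZassenhaus1962, (cited through Marseglia2019 Remark 3.8)] -/
theorem exists_isUnit_extended_eq (hf : R⁰ ≤ Submonoid.comap (algebraMap R T) T⁰) {J : FractionalIdeal T⁰ K}
    (hJ : IsUnit J) : ∃ I : FractionalIdeal R⁰ K, IsUnit I ∧ I.extended K hf = J := by
  obtain ⟨I, hI, h⟩ := exists_isUnit_span_coe_eq_coe (R := R) hJ
  exact ⟨I, hI, coeToSubmodule_injective ((coe_extended_algebraMap_eq_span hf I).trans h)⟩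

/-- **`𝓘(R) → 𝓘(T)`, `I ↦ I·T`, is SURJECTIVE** — the group-homomorphism packaging (`Units.map` of Mathlib's ring
homomorphism `FractionalIdeal.extendedHom'`). [cite: Marseglia2019, §3 Remark 3.8, p. 6]
[cite: DadeTausskyZassenhaus1962, (cited through Marseglia2019 Remark 3.8)] -/
theorem unitsMap_extendedHom'_surjective (hf : R⁰ ≤ Submonoid.comap (algebraMap R T) T⁰) :
    Function.Surjective (Units.map (extendedHom' (A := R) (K := K) K hf).toMonoidHom) := by
  intro J
  obtain ⟨I, hI, h⟩ := exists_isUnit_extended_eq hf J.isUnit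
  exact ⟨hI.unit, Units.ext (by rw [Units.coe_map, IsUnit.unit_spec]; exact h)⟩

end Surjective

end NumberRing

/-! ## §4 The arbitrary-order series: `𝔯 = endOrder (M_μ) ≤ S = endOrder (M_ν)` inside a number field `K` -/

namespace CMTypeLattice

variable {K : Type} [Field K] [NumberField K]
variable {ι : Type} [Fintype ι] [DecidableEq ι] (μ ν : Basis ι ℚ K)

/-- `𝔯 ∖ 0 → S ∖ 0` along the inclusion of the order `𝔯 = endOrder (M_μ)` in its over-order `S = endOrder (M_ν)` —
the hypothesis of Mathlib's `FractionalIdeal.extended` for `f = Subring.inclusion` (plumbing).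
[cite: Marseglia2019, §2 («The fractional `R`-ideals that are rings are called over-orders of `R`»: `R ⊆ S ⊂ K`), p. 4] -/
theorem nonZeroDivisors_le_comap_inclusion
    (hle : endOrder (Algebra.leftMulMatrix μ) ≤ endOrder (Algebra.leftMulMatrix ν)) :
    (endOrder (Algebra.leftMulMatrix μ))⁰ ≤
      Submonoid.comap (Subring.inclusion hle) (endOrder (Algebra.leftMulMatrix ν))⁰ :=
  nonZeroDivisors_le_comap_nonZeroDivisors_of_injective _ (Subring.inclusion_injective hle)

/-- The over-order `S = endOrder (M_ν) ⊇ 𝔯 = endOrder (M_μ)` is INTEGRAL over `𝔯` (its elements are algebraic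
integers; plumbing, with the `𝔯`-algebra structure of the inclusion). [cite: Marseglia2019, §2 («an over-order
of `R` … is also an order»), p. 4] [cite: Shimura1998, §7.1 («`𝔯` is an order»), p. 48] -/
theorem isIntegral_inclusion [Nonempty ι]
    (hle : endOrder (Algebra.leftMulMatrix μ) ≤ endOrder (Algebra.leftMulMatrix ν)) :
    (Subring.inclusion hle).IsIntegral := fun s ↦ by
  obtain ⟨p, hp, hps⟩ := isIntegral_of_mem_endOrder (ρ := Algebra.leftMulMatrix ν) s.2
  refine ⟨p.map (Int.castRingHom _), hp.map _, Subtype.val_injective ?_⟩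
  change ((Polynomial.eval₂ (Subring.inclusion hle) s (p.map (Int.castRingHom _)) :
      endOrder (Algebra.leftMulMatrix ν)) : K) = ((0 : endOrder (Algebra.leftMulMatrix ν)) : K)
  rw [Polynomial.eval₂_map, RingHom.ext_int ((Subring.inclusion hle).comp (Int.castRingHom _)) (Int.castRingHom _),
    ZeroMemClass.coe_zero, show ((Polynomial.eval₂ (Int.castRingHom _) s p : endOrder (Algebra.leftMulMatrix ν)) : K) =
      (endOrder (Algebra.leftMulMatrix ν)).subtype (Polynomial.eval₂ (Int.castRingHom _) s p) from rfl,
    Polynomial.hom_eval₂, RingHom.ext_int (((endOrder (Algebra.leftMulMatrix ν)).subtype).comp (Int.castRingHom _))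
      (algebraMap ℤ K)]
  exact hps

/-- **MARSEGLIA REMARK 3.8 / DADE–TAUSSKY–ZASSENHAUS for the orders of the series: every invertible fractional
ideal `L′` of the over-order `S = endOrder (M_ν) ⊇ 𝔯 = endOrder (M_μ)` is `L·S = FractionalIdeal.extended K _ L`
for an INVERTIBLE fractional `𝔯`-ideal `L`** («if `S` is an over-order of `R`, then the extension map `I ↦ IS`
induces a surjective group homomorphism `Pic(R) ↠ Pic(S)`»), `K` a number field of any degree, `𝔯` any order.
[cite: Marseglia2019, §3 Remark 3.8, p. 6; §4, proof of Prop. 4.1 ((3) ⟹ (1)), p. 8]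
[cite: DadeTausskyZassenhaus1962, (cited through Marseglia2019 Remark 3.8)] -/
theorem exists_isUnit_extended_inclusion_eq [Nonempty ι]
    [IsFractionRing (endOrder (Algebra.leftMulMatrix μ)) K] [IsFractionRing (endOrder (Algebra.leftMulMatrix ν)) K]
    (hle : endOrder (Algebra.leftMulMatrix μ) ≤ endOrder (Algebra.leftMulMatrix ν))
    {L' : FractionalIdeal (endOrder (Algebra.leftMulMatrix ν))⁰ K} (hL' : IsUnit L') :
    ∃ L : FractionalIdeal (endOrder (Algebra.leftMulMatrix μ))⁰ K, IsUnit L ∧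
      L.extended K (nonZeroDivisors_le_comap_inclusion μ ν hle) = L' := by
  haveI := isNoetherianRing_endOrder (Algebra.leftMulMatrix μ)
  haveI := dimensionLEOne_endOrder (Algebra.leftMulMatrix μ)
  haveI := isNoetherianRing_endOrder (Algebra.leftMulMatrix ν)
  haveI := dimensionLEOne_endOrder (Algebra.leftMulMatrix ν)
  letI : Algebra (endOrder (Algebra.leftMulMatrix μ)) (endOrder (Algebra.leftMulMatrix ν)) :=
    (Subring.inclusion hle).toAlgebra
  haveI : IsScalarTower (endOrder (Algebra.leftMulMatrix μ)) (endOrder (Algebra.leftMulMatrix ν)) K :=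
    IsScalarTower.of_algebraMap_eq (R := endOrder (Algebra.leftMulMatrix μ))
      (S := endOrder (Algebra.leftMulMatrix ν)) (A := K) fun _ ↦ rfl
  haveI : Algebra.IsIntegral (endOrder (Algebra.leftMulMatrix μ)) (endOrder (Algebra.leftMulMatrix ν)) :=
    ⟨isIntegral_inclusion μ ν hle⟩
  exact NumberRing.exists_isUnit_extended_eq _ hL'

/-- **Span form: every `L′ ∈ 𝓘(S)` is the `S`-module spanned by an invertible `𝔯`-ideal, `↑L′ = span_S ↑L`,
`L ∈ 𝓘(𝔯)`** (`𝔯 = endOrder (M_μ) ≤ S = endOrder (M_ν)`; «Let `L′` be any invertible ideal in `R` such that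
`L′S = L` … such an `L′` exists»). [cite: Marseglia2019, §4, proof of Prop. 4.1 ((3) ⟹ (1)), p. 8; §3 Remark
3.8, p. 6] -/
theorem exists_isUnit_span_coe_eq_coe [Nonempty ι]
    (hle : endOrder (Algebra.leftMulMatrix μ) ≤ endOrder (Algebra.leftMulMatrix ν))
    {L' : FractionalIdeal (endOrder (Algebra.leftMulMatrix ν))⁰ K} (hL' : IsUnit L') :
    ∃ L : FractionalIdeal (endOrder (Algebra.leftMulMatrix μ))⁰ K, IsUnit L ∧
      Submodule.span (endOrder (Algebra.leftMulMatrix ν)) (L : Set K) =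
        (L' : Submodule (endOrder (Algebra.leftMulMatrix ν)) K) := by
  haveI := isFractionRing_endOrder (K := K) (Algebra.leftMulMatrix μ)
  haveI := isFractionRing_endOrder (K := K) (Algebra.leftMulMatrix ν)
  letI : Algebra (endOrder (Algebra.leftMulMatrix μ)) (endOrder (Algebra.leftMulMatrix ν)) :=
    (Subring.inclusion hle).toAlgebra
  haveI : IsScalarTower (endOrder (Algebra.leftMulMatrix μ)) (endOrder (Algebra.leftMulMatrix ν)) K :=
    IsScalarTower.of_algebraMap_eq (R := endOrder (Algebra.leftMulMatrix μ))
      (S := endOrder (Algebra.leftMulMatrix ν)) (A := K) fun _ ↦ rfl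
  obtain ⟨L, hL, h⟩ := exists_isUnit_extended_inclusion_eq μ ν hle hL'
  refine ⟨L, hL, ?_⟩
  rw [← h]
  exact (NumberRing.coe_extended_algebraMap_eq_span (R := endOrder (Algebra.leftMulMatrix μ))
    (T := endOrder (Algebra.leftMulMatrix ν)) _ L).symm

/-- **`𝓘(𝔯) → 𝓘(S)`, `L ↦ L·S`, is SURJECTIVE** for the order `𝔯 = endOrder (M_μ)` and any over-order
`S = endOrder (M_ν)` (group-homomorphism packaging through Mathlib's `FractionalIdeal.extendedHom'` along the
inclusion). [cite: Marseglia2019, §3 Remark 3.8, p. 6] [cite: DadeTausskyZassenhaus1962, (cited through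
Marseglia2019 Remark 3.8)] -/
theorem unitsMap_extendedHom'_inclusion_surjective [Nonempty ι]
    [IsFractionRing (endOrder (Algebra.leftMulMatrix μ)) K] [IsFractionRing (endOrder (Algebra.leftMulMatrix ν)) K]
    (hle : endOrder (Algebra.leftMulMatrix μ) ≤ endOrder (Algebra.leftMulMatrix ν)) :
    Function.Surjective (Units.map (extendedHom' (A := endOrder (Algebra.leftMulMatrix μ)) (K := K) K
      (nonZeroDivisors_le_comap_inclusion μ ν hle)).toMonoidHom) := by
  intro L'
  obtain ⟨L, hL, h⟩ := exists_isUnit_extended_inclusion_eq μ ν hle L'.isUnit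
  exact ⟨hL.unit, Units.ext (by rw [Units.coe_map, IsUnit.unit_spec]; exact h)⟩

/-- **`↑(N·P) = span_S ↑N`** for the `𝔯`-ideal `P` with the lattice of the over-order `S` (`↑P = S`): the product on
the base carrier `FractionalIdeal 𝔯⁰ K` computes the extension `N·S` (bookkeeping between the two readings of
«`IS`»). [cite: Marseglia2019, §2 («`IJ` … generated by the elements of the form `ij`»; «`IS = I`»), p. 4] -/
theorem coe_mul_eq_span_of_coe_eq {N P : FractionalIdeal (endOrder (Algebra.leftMulMatrix μ))⁰ K}
    (hP : (P : Set K) = (endOrder (Algebra.leftMulMatrix ν) : Set K)) :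
    ((N * P : FractionalIdeal (endOrder (Algebra.leftMulMatrix μ))⁰ K) : Set K) =
      (Submodule.span (endOrder (Algebra.leftMulMatrix ν)) (N : Set K) : Set K) := by
  have hmemP : ∀ {s : K}, s ∈ P ↔ s ∈ endOrder (Algebra.leftMulMatrix ν) := fun {s} ↦ by
    rw [← SetLike.mem_coe, hP, SetLike.mem_coe]
  ext y
  rw [← coeToSet_coeToSubmodule (N * P), SetLike.mem_coe, SetLike.mem_coe, coe_mul]
  constructor
  · intro hy
    refine Submodule.mul_induction_on hy (fun n hn q hq ↦ ?_) fun x y hx hy ↦ Submodule.add_mem _ hx hy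
    have : (⟨q, hmemP.1 hq⟩ : endOrder (Algebra.leftMulMatrix ν)) • n ∈
        Submodule.span (endOrder (Algebra.leftMulMatrix ν)) (N : Set K) :=
      Submodule.smul_mem _ _ (Submodule.subset_span hn)
    rw [mul_comm]
    exact this
  · intro hy
    induction hy using Submodule.span_induction with
    | mem n hn =>
      rw [← mul_one n]
      exact Submodule.mul_mem_mul hn (hmemP.2 (endOrder (Algebra.leftMulMatrix ν)).one_mem)
    | zero => exact Submodule.zero_mem _
    | add x y _ _ hx hy => exact Submodule.add_mem _ hx hy
    | smul s x _ hx =>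
      -- `↑N·↑P` is stable under `S`: `s·(n·p) = n·(s·p)`, `s·p ∈ P` since `↑P = S` is a ring
      rw [Subring.smul_def, smul_eq_mul]
      refine Submodule.mul_induction_on hx (fun n hn q hq ↦ ?_) fun x y hx hy ↦ by
        rw [mul_add]; exact Submodule.add_mem _ hx hy
      rw [mul_left_comm]
      exact Submodule.mul_mem_mul hn (hmemP.2 (mul_mem s.2 (hmemP.1 hq)))

/-- **The `Pic(S)`-stratum of `ICM(𝔯)` is the image of `𝓘(𝔯)`: an `𝔯`-ideal `L` with multiplicator ring
`S = (L:L)` that is invertible in `S` (`L·(S:L) = S`) is `L₀·P` with `L₀ ∈ 𝓘(𝔯)` and `P` the `𝔯`-ideal `↑P = S`**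
— the base-carrier reading of «`Pic(R) ↠ Pic(S)`» used by `CMOrderWeakClassesCount` / `CMOrderOverorderPicardClasses`
(THEOREM 4.6: `Pic(S)` acts simply transitively on `ICM_S`). [cite: Marseglia2019, §3 Remark 3.8, p. 6; §4 Thm. 4.6,
p. 9] [cite: DadeTausskyZassenhaus1962, (cited through Marseglia2019 Remark 3.8)] -/
theorem exists_isUnit_mul_eq_of_mul_div_self_div_eq [Nonempty ι]
    [IsFractionRing (endOrder (Algebra.leftMulMatrix μ)) K]
    (hle : endOrder (Algebra.leftMulMatrix μ) ≤ endOrder (Algebra.leftMulMatrix ν))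
    {L P : FractionalIdeal (endOrder (Algebra.leftMulMatrix μ))⁰ K}
    (hP : (P : Set K) = (endOrder (Algebra.leftMulMatrix ν) : Set K)) (hL0 : L ≠ 0)
    (hLS : ((L / L : FractionalIdeal (endOrder (Algebra.leftMulMatrix μ))⁰ K) : Set K) =
      (endOrder (Algebra.leftMulMatrix ν) : Set K)) (hinv : L * (L / L / L) = L / L) :
    ∃ L₀ : FractionalIdeal (endOrder (Algebra.leftMulMatrix μ))⁰ K, IsUnit L₀ ∧ L₀ * P = L := by
  obtain ⟨I, hI⟩ := exists_units_coe_eq_of_mul_div_self_div_eq μ ν hL0 hLS hinv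
  obtain ⟨L₀, hL₀, h⟩ := exists_isUnit_span_coe_eq_coe μ ν hle I.isUnit
  refine ⟨L₀, hL₀, SetLike.coe_injective ?_⟩
  rw [coe_mul_eq_span_of_coe_eq μ ν hP, h, coeToSet_coeToSubmodule, hI]

end CMTypeLattice

/-! ## §5 The maximal order: every fractional ideal of `𝒪 = 𝓞_K` is `I·𝒪` with `I ∈ 𝓘(𝔯)` -/

namespace EndOrder

variable {K : Type} [Field K] [NumberField K]
variable {ι : Type} [Fintype ι] [DecidableEq ι] [Nonempty ι] (ρ : K →ₐ[ℚ] Matrix ι ι ℚ)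
variable [IsFractionRing (endOrder ρ) K]

/-- **Every nonzero fractional ideal of the maximal order `𝒪 = 𝓞_K` is `I·𝒪 = extend ρ I` for an INVERTIBLE
fractional ideal `I` of the (arbitrary) order `𝔯 = endOrder ρ`** — the ideal-level form of «`Pic(R) → Pic(𝒪_K)`
is surjective» (the class-level form is the tree's `CMOrderPicardSurjective.classGroupMap_surjective`, proved
there through ideals coprime to the conductor; here by the local method of §3).
[cite: Marseglia2019, §3 Remark 3.8 and (3.1), p. 6; §6 («`I ↦ I𝒪_K` induces a surjective group homomorphism
from `Pic(R)` to `Pic(𝒪_K)`»), p. 13] [cite: Stevenhagen2008NumberRings, §6 Thm. 6.7, p. 225] -/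
theorem exists_isUnit_extend_eq {J : FractionalIdeal (𝓞 K)⁰ K} (hJ0 : J ≠ 0) :
    ∃ I : FractionalIdeal (endOrder ρ)⁰ K, IsUnit I ∧ extend ρ I = J := by
  letI := algebraRingOfIntegers ρ
  haveI := CMTypeLattice.isNoetherianRing_endOrder ρ
  haveI := CMTypeLattice.dimensionLEOne_endOrder ρ
  have hJ : IsUnit J := isUnit_iff_ne_zero.2 hJ0
  obtain ⟨I, hI, h⟩ := NumberRing.exists_isUnit_span_coe_eq_coe (R := endOrder ρ) hJ
  exact ⟨I, hI, coeToSubmodule_injective ((coe_extend ρ I).trans h)⟩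

end EndOrder

end Literature.NumberTheory.ComplexMultiplication
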